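import Literature.IUT.LogVolume.DHExplicitSzpiroAssembly
import Literature.IUT.LogVolume.DHBabySzpiroCorrected
import HarnessLib

/-!
# Dupuy–Hilado (arXiv:2004.13108v2) §8.4 Lemma 8.4.1 (8.5)–(8.6), "where discriminants for `K` meet
# conductors using Néron–Ogg–Shafarevich": what Thm 3.9.2 (as typed) yields — PROVED — and the §8.6
# assembly (8.10) run on that

PROOF-ONLY sequel of `DHExplicitSzpiroAssembly` (T. Dupuy, A. Hilado, arXiv:2004.13108v2 [DupuyHilado2020],
UNREFEREED; held render `book:anonnd-2004-13108v2`, locators `p.N l.M`). No new definition, no new `Prop`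
fact. Cited BY NAME: the typed candidates `Lemma841` (Lemma 8.4.1 (8.5)), `RamifiedIffConductorOrDifferent`
(Thm 3.9.2, NOS as printed), `Ineq89`, `ArchBound83`, `LargePlacesBound84`, `SmallPlacesBound87`,
`PilotDegreeFormula`, `Ineq810`, `epsExplicit`, `explicitCoeff_eq` (`DHExplicitSzpiro`); `ndegLgp_thetaPilot`
(`DHProbabilisticSzpiroCorrected`); `residueChar_dvd_discr_of_ramIdx_ne_one` (`DHBabySzpiroCorrected`);
the tree's `ramIdx`, `resDeg`, `residueChar`, `placesOver`, `sum_localDegree`, `absNorm_eq`,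
`WeierstrassCurve.conductor`/`conductorNorm`; Mathlib's `NumberField.not_dvd_discr_iff_forall_mem`,
`HeightOneSpectrum.under`.

## The printed argument (Lemma 8.4.1 p.32 l.51–59; proof p.33 l.1–35; footnote 12 p.32 l.60–61)

(8.5): "`Σ_{p | |Disc(K/ℚ)|, p > B} ln(p) ≤ 2(ln|Disc(F/ℚ)|/[F:ℚ] + ln|Cond(E/F)|/[F:ℚ])`". Proof: "for
`p > B` … `p | |Disc(K/ℚ)| ⟺ p | |Disc(F/ℚ)| or p | |Cond(E/F)|`" (l.3, Thm 3.9.2 = NOS), then p-parts and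
"`d(w/p) = e(w/p) − 1` since `p_w > B`" reduce it to **(8.6)** "`2·Σ_{w|p}(f(w/p)(e(w/p)−1) + f(w/p)c_E(w))
/[F:ℚ] ≥ 1`" for each such `p` (l.22–26), concluded by "Using that `p > B` and `2(e(w/p)−1) ≥ e(w/p)`
together with `Σ_{w∈V(F)_p} f(w/p)e(w/p) = [F:ℚ]`" (l.27–33).

## What is PROVED here

* `exists_ramIdx_ne_one_of_dvd_discr` — Dedekind's discriminant theorem, converse direction
  (`p | Disc(K/ℚ) ⇒` some place of `K` over `p` has `e ≠ 1`), from Mathlib; `residueChar_under`,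
  `residueChar_dvd_conductorNorm_of_le` — bookkeeping for the place `w ∩ 𝓞_F` below `w` and for `v | 𝔣(E/F)`.
* `sum_log_largePrimes_discr_le_of_NOS` — **what l.3 (NOS, the typed `RamifiedIffConductorOrDifferent E l`
  for `F ⊆ K`) actually yields, PROVED for every `B ≥ l`**:
  `Σ_{p | |Disc(K/ℚ)|, p > B} ln p ≤ ln|Disc(F/ℚ)| + ln|Cond(E/F)|` — print's (8.5) WITHOUT the factor
  `2/[F:ℚ]` (each such `p` divides `|Disc(F/ℚ)|` or `N𝔣(E/F)`, and `Σ_{p|n} ln p ≤ ln n`).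
* `finrank_le_two_mul_sum_of_forall_ramified` — the printed closing step of (8.6) ("`2(e(w/p)−1) ≥ e(w/p)`"
  summed against `Σ_w f e = [F:ℚ]`) PROVED under the hypothesis it needs: EVERY place of `F` over `p` is
  ramified (`e ≥ 2`). Typing note (no judgement on the theorem, a note on the printed inference): the
  display "`2(e(w/p)−1) ≥ e(w/p)`" is false at a place with `e(w/p) = 1`, and a prime `p > B` dividing
  `|Disc(K/ℚ)|` may have both ramified and unramified places of `F` above it (`F/ℚ` need not be Galois:
  `F₀ = ℚ(j_E)` is arbitrary; and `F = F₀(√−1, E₀[30])` ramifies over a prime `𝔭 | p` of `F₀` where `E₀` is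
  bad but not over a prime `𝔭' | p` where it is good). UNFORMALISED REMARK: if `p > B` splits completely in
  `F₀` with `[F₀:ℚ] = d₀ ≥ 3` and `E₀` has multiplicative reduction at exactly one prime `𝔭 | p`, the left
  side of (8.6) evaluates to `2·e(𝔭/p)f(𝔭/p)/d₀ = 2/d₀ < 1`; no such example is constructed in the kernel.
  The typed `Lemma841` therefore stays a candidate; the unconditional consequence of NOS is the weak form
  above, and the step that would upgrade it is isolated as `finrank_le_two_mul_sum_of_forall_ramified`.
* `ineq810_weak_of_inputs` — the §8.6 assembly (p.35 l.1–59) run with the weak form in place of (8.5):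
  `(1/(24+ε_l))·ln|Δ^min_{E/F}| ≤ [ln(B)π(B) + ln(π)]·[F:ℚ] + ([F:ℚ]/4)·(ln|Disc(F/ℚ)| + ln|Cond(E/F)|)`
  — the coefficient of the conductor–discriminant term is `[F:ℚ]/4` where print's (8.10) has `1`
  (print's `1` = `((l+5)/2)·(2/[F:ℚ])·[F:ℚ]/(l+5)`, using the proof's `(l+5)/2` for (8.4), p.32 l.46–49;
  the statement (8.4) p.31 l.39–44 prints `(l+5)/4`, as typed in `LargePlacesBound84`). Consequently the
  exponent of `|Cond(E/F)|·|Disc(F/ℚ)|` in the multiplicative form becomes `(24+ε_l)·[F:ℚ]/4 ≤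
  (24+ε_l)·d₁d₀/4` — explicit, but not the uniform `24 + ε_l` of Thm 1.0.5, unless (8.5) is supplied.
  `ineq810_weak_of_NOS` feeds it from NOS-as-typed.
* (appended, lit-abc-dupuyhilado gen 6) `sum_log_largePrimes_discr_le_of_NOS_onlyIf`,
  `ineq810_weak_of_NOS_onlyIf` — the same two results from the (⟹) HALF of Thm 3.9.2 only ("`e(w/p) > 1 ⟹
  w ∣ Cond(E/F) or w ∣ Diff(F/ℚ)`", the Néron–Ogg–Shafarevich direction its proof p.15 l.31–37 establishes
  and the only one the proof of (8.5) uses); the typed iff's converse (p.16 l.2–3, "`v ∣ Cond ⟺ v is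
  ramified ⟺ I_{w/v} ≠ 1`") passes from `T_l` to the single level `l` and fails in general (multiplicative
  `v ∤ l` with `l ∣ ord_v(q_v)`: `F_v(E[l]) = F_v(ζ_l, q_v^{1/l})` is unramified), so the `_onlyIf` forms
  carry the hypothesis that is true in print's setting; the iff forms are now their one-line corollaries.

HONEST FRAMING: (8.9) `Ineq89` (the authors' reading of the DISPUTED [IUTchIII] Cor. 3.12
[claim: Mochizuki2012, status: disputed]), (8.3), (8.4), (8.7), (3.2) and Thm 3.9.2 as typed
[claim: DupuyHilado2020, status: under-review] are hypotheses, never asserted. Nothing here refutes the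
printed Lemma 8.4.1 or Thm 1.0.5 (no counterexample is constructed); what is certified is which inequality
the printed ingredients prove. Typed ≠ proved ≠ endorsed; no side is taken on any author; no abc claim.
-/

noncomputable section

namespace Literature.IUT.LogVolume

open NumberField IsDedekindDomain Finset

/-! ## Classical inputs (Mathlib) -/
section Classical

variable (K : Type*) [Field K] [NumberField K]

/-- **Dedekind's discriminant theorem, converse direction** (print p.33 l.3, "`p | |Disc(K/ℚ)| ⟺ …`",
left-to-right needs a ramified place above `p`): if `p ∣ Disc(K/ℚ)` then some finite place `w` of `K` with
`char κ(w) = p` has `e(w/p) ≠ 1`. PROVED from Mathlib (`NumberField.not_dvd_discr_iff_forall_mem`,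
`Ideal.ramificationIdx_eq_one_iff`). [cite: DupuyHilado2020, Lemma 8.4.1 proof p.33 l.1–4] -/
theorem exists_ramIdx_ne_one_of_dvd_discr {p : ℕ} (hp : p.Prime) (h : (p : ℤ) ∣ NumberField.discr K) :
    ∃ w : HeightOneSpectrum (𝓞 K), residueChar K w = p ∧ ramIdx K w ≠ 1 := by
  have hpZ : Prime (p : ℤ) := Nat.prime_iff_prime_int.mp hp
  have h1 := not_iff_not.mpr (NumberField.not_dvd_discr_iff_forall_mem K (𝓞 K) hpZ)
  rw [not_not] at h1
  have h2 := h1.mp h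
  push Not at h2
  obtain ⟨P, hP, hpP, hunr⟩ := h2
  have hPne : P ≠ ⊥ := by
    intro hbot
    rw [hbot] at hpP
    have : ((p : ℤ) : 𝓞 K) = 0 := by simpa using hpP
    exact hpZ.ne_zero (by exact_mod_cast this)
  let w : HeightOneSpectrum (𝓞 K) := ⟨P, hP, hPne⟩
  have hunder : P.under ℤ = Ideal.span {(p : ℤ)} := by
    refine ((PrincipalIdealRing.isMaximal_of_irreducible hpZ.irreducible).eq_of_le
      (Ideal.IsPrime.under ℤ P).ne_top ?_).symm
    rw [Ideal.span_le, Set.singleton_subset_iff]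
    simpa [Ideal.mem_comap] using hpP
  have hchar : residueChar K w = p := by
    show Ideal.absNorm (P.under ℤ) = p
    rw [hunder, Ideal.absNorm_span_singleton]
    simp
  refine ⟨w, hchar, ?_⟩
  intro h1
  apply hunr
  haveI : w.asIdeal.LiesOver (Ideal.span {(residueChar K w : ℤ)}) := liesOver_residueChar K w
  have hne : Ideal.span {(residueChar K w : ℤ)} ≠ ⊥ := by simp [(residueChar_prime K w).ne_zero]
  have h2 : ramIdx K w = w.asIdeal.ramificationIdx ℤ := by
    unfold ramIdx
    exact Ideal.ramificationIdx'_eq_ramificationIdx (p := Ideal.span {(residueChar K w : ℤ)})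
      (q := w.asIdeal) hne
  rw [h2] at h1
  exact Ideal.ramificationIdx_eq_one_iff.mp h1

/-- `Σ_{p | n} ln p = ln rad(n) ≤ ln n` for `n ≠ 0`. Elementary. [cite: DupuyHilado2020, Lemma 8.4.1 proof p.33 l.5–21] -/
theorem sum_log_primeFactors_le_log (n : ℕ) (hn : n ≠ 0) :
    ∑ p ∈ n.primeFactors, Real.log p ≤ Real.log n := by
  rw [← Real.log_prod (s := n.primeFactors) (f := fun p => (p : ℝ))
    (fun p hp => by exact_mod_cast (Nat.prime_of_mem_primeFactors hp).ne_zero)]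
  have h1 : (1 : ℝ) ≤ ∏ p ∈ n.primeFactors, (p : ℝ) := by
    rw [← Nat.cast_prod]
    exact_mod_cast Nat.one_le_iff_ne_zero.mpr (Finset.prod_ne_zero_iff.mpr fun p hp =>
      (Nat.prime_of_mem_primeFactors hp).ne_zero)
  refine Real.log_le_log (by linarith) ?_
  rw [← Nat.cast_prod]
  exact_mod_cast Nat.le_of_dvd (Nat.pos_of_ne_zero hn) (Nat.prod_primeFactors_dvd n)

variable (F : Type*) [Field F] [NumberField F] [Algebra F K]

omit [NumberField K] [NumberField F] in
/-- The place `w ∩ 𝓞_F` of `F` below a finite place `w` of `K` (Mathlib's `HeightOneSpectrum.under`) has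
the same residue characteristic. [cite: DupuyHilado2020, Thm 3.9.2 p.15 l.27–30] -/
theorem residueChar_under (w : HeightOneSpectrum (𝓞 K)) :
    residueChar F (w.under (𝓞 F)) = residueChar K w := by
  unfold residueChar
  rw [HeightOneSpectrum.under_asIdeal, Ideal.under_under]

/-- If `𝔣(E/F) ≤ v` (i.e. "`v | Cond(E/F)`") then `char κ(v) ∣ N𝔣(E/F)` (`conductorNorm = absNorm 𝔣`,
`N(v) = p^{f_v}`). [cite: DupuyHilado2020, Lemma 8.4.1 proof p.33 l.12–21] -/
theorem residueChar_dvd_conductorNorm_of_le (E : WeierstrassCurve F) (v : HeightOneSpectrum (𝓞 F))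
    (h : E.conductor (𝓞 F) ≤ v.asIdeal) : residueChar F v ∣ E.conductorNorm (𝓞 F) := by
  have h1 : Ideal.absNorm v.asIdeal ∣ E.conductorNorm (𝓞 F) := Ideal.absNorm_dvd_absNorm_of_le h
  rw [absNorm_eq] at h1
  exact (dvd_pow_self _ (resDeg_ne_zero F v)).trans h1

/-- **The closing step of (8.6) under the hypothesis it needs**: if EVERY place `v` of `F` over `p` is
ramified (`e(v/p) ≥ 2`, so that "`2(e(v/p) − 1) ≥ e(v/p)`", p.33 l.27), then
`[F:ℚ] = Σ_{v|p} f(v/p)e(v/p) ≤ 2·Σ_{v|p} f(v/p)(e(v/p) − 1)`. At a place with `e = 1` the displayed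
inequality `2(e−1) ≥ e` fails; see the module docstring. [cite: DupuyHilado2020, Lemma 8.4.1 proof (8.6) p.33 l.22–35] -/
theorem finrank_le_two_mul_sum_of_forall_ramified (p : ℕ) [Fact p.Prime]
    (h : ∀ v ∈ placesOver F p, 2 ≤ ramIdx F v) :
    Module.finrank ℚ F ≤ 2 * ∑ v ∈ placesOver F p, resDeg F v * (ramIdx F v - 1) := by
  rw [← sum_localDegree F p, Finset.mul_sum]
  refine Finset.sum_le_sum fun v hv => ?_
  have h2 := h v hv
  unfold localDegree
  have : ramIdx F v ≤ 2 * (ramIdx F v - 1) := by omega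
  calc ramIdx F v * resDeg F v ≤ 2 * (ramIdx F v - 1) * resDeg F v := Nat.mul_le_mul_right _ this
    _ = 2 * (resDeg F v * (ramIdx F v - 1)) := by ring

end Classical

namespace ExplicitSzpiro

/-! ## §8.4: what NOS (Thm 3.9.2 as typed) yields for the large primes dividing `Disc(K/ℚ)` -/

/-- **Lemma 8.4.1, the form that follows from the (⟹) HALF of Thm 3.9.2 — PROVED**: for number fields
`F ⊆ K`, a curve `E/F`, `l ≤ B`, and the hypothesis "`e(w/p) > 1 ⟹ w | Cond(E/F) or w | Diff(F/ℚ)` for places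
`w ∤ l` of `K` over `v`" (the ONLY direction of Thm 3.9.2 p.15 l.30 that the printed proof of (8.5) uses,
p.33 l.1–21, and the direction its own proof p.15 l.31–37 establishes from Néron–Ogg–Shafarevich; the
converse p.16 l.2–3 reads «v ∣ Cond ⟺ v is ramified ⟺ I_{w/v} ≠ 1», i.e. passes from `T_l` to the single
level `l`, and fails e.g. at a multiplicative `v ∤ l` with `l ∣ ord_v(q_v)`): every prime `p > B` dividing
`|Disc(K/ℚ)|` divides `|Disc(F/ℚ)|` or `N𝔣(E/F)`, hence `Σ_{p | |Disc(K/ℚ)|, p>B} ln p ≤ ln|Disc(F/ℚ)| + ln N𝔣(E/F)`.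
[cite: DupuyHilado2020, Thm 3.9.2 p.15 l.27–37; Lemma 8.4.1 (8.5) p.32 l.51–59, proof p.33 l.1–21] -/
theorem sum_log_largePrimes_discr_le_of_NOS_onlyIf {F : Type*} [Field F] [NumberField F]
    (K : Type*) [Field K] [NumberField K] [Algebra F K] (E : WeierstrassCurve F) (l B : ℕ) (hlB : l ≤ B)
    (hNOS : ∀ (w : HeightOneSpectrum (𝓞 K)) (v : HeightOneSpectrum (𝓞 F)), w.asIdeal.under (𝓞 F) = v.asIdeal →
      residueChar K w ≠ l → 1 < ramIdx K w → E.conductor (𝓞 F) ≤ v.asIdeal ∨ 1 < ramIdx F v) :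
    (∑ p ∈ (NumberField.discr K).natAbs.primeFactors.filter (fun p => B < p), Real.log p) ≤
      Real.log |(NumberField.discr F : ℝ)| + Real.log (E.conductorNorm (𝓞 F)) := by
  have hDF : (NumberField.discr F).natAbs ≠ 0 := Int.natAbs_ne_zero.mpr (NumberField.discr_ne_zero F)
  have hN : E.conductorNorm (𝓞 F) ≠ 0 := (conductorNorm_ringOfIntegers_pos E).ne'
  -- every large prime of `Disc(K/ℚ)` divides `|Disc(F/ℚ)|` or `N𝔣(E/F)`
  have hsub : (NumberField.discr K).natAbs.primeFactors.filter (fun p => B < p) ⊆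
      (NumberField.discr F).natAbs.primeFactors ∪ (E.conductorNorm (𝓞 F)).primeFactors := by
    intro p hp
    rw [Finset.mem_filter, Nat.mem_primeFactors] at hp
    obtain ⟨⟨hpp, hpd, -⟩, hBp⟩ := hp
    obtain ⟨w, hw, hram⟩ := exists_ramIdx_ne_one_of_dvd_discr K hpp (Int.natCast_dvd.mpr hpd)
    have h1 : 1 < ramIdx K w :=
      lt_of_le_of_ne (Nat.one_le_iff_ne_zero.mpr (ramIdx_ne_zero K w)) (Ne.symm hram)
    have hne : residueChar K w ≠ l := by rw [hw]; omega
    have hv : w.asIdeal.under (𝓞 F) = (w.under (𝓞 F)).asIdeal := (HeightOneSpectrum.under_asIdeal _ _).symm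
    have hchar : residueChar F (w.under (𝓞 F)) = p := by rw [residueChar_under K F w, hw]
    rcases hNOS w (w.under (𝓞 F)) hv hne h1 with hc | hr
    · have hd := residueChar_dvd_conductorNorm_of_le F E _ hc
      rw [hchar] at hd
      exact Finset.mem_union_right _ (Nat.mem_primeFactors.mpr ⟨hpp, hd, hN⟩)
    · have hd := residueChar_dvd_discr_of_ramIdx_ne_one F (w.under (𝓞 F)) (Ne.symm (ne_of_lt hr))
      rw [hchar] at hd
      exact Finset.mem_union_left _ (Nat.mem_primeFactors.mpr ⟨hpp, Int.natCast_dvd.mp hd, hDF⟩)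
  have hlog0 : ∀ p ∈ (NumberField.discr F).natAbs.primeFactors ∪ (E.conductorNorm (𝓞 F)).primeFactors,
      0 ≤ Real.log p := fun p _ => Real.log_natCast_nonneg p
  calc (∑ p ∈ (NumberField.discr K).natAbs.primeFactors.filter (fun p => B < p), Real.log p)
      ≤ ∑ p ∈ (NumberField.discr F).natAbs.primeFactors ∪ (E.conductorNorm (𝓞 F)).primeFactors,
          Real.log p := Finset.sum_le_sum_of_subset_of_nonneg hsub (fun p hp _ => hlog0 p hp)
    _ ≤ (∑ p ∈ (NumberField.discr F).natAbs.primeFactors, Real.log p) +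
          ∑ p ∈ (E.conductorNorm (𝓞 F)).primeFactors, Real.log p := by
        rw [← Finset.sum_union_inter]
        linarith [Finset.sum_nonneg fun p (hp : p ∈ (NumberField.discr F).natAbs.primeFactors ∩
          (E.conductorNorm (𝓞 F)).primeFactors) => Real.log_natCast_nonneg p]
    _ ≤ Real.log |(NumberField.discr F : ℝ)| + Real.log (E.conductorNorm (𝓞 F)) := by
        have h1 := sum_log_primeFactors_le_log _ hDF
        have h2 := sum_log_primeFactors_le_log _ hN
        rw [Nat.cast_natAbs, Int.cast_abs] at h1
        exact add_le_add h1 h2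

/-- **Lemma 8.4.1, the form that follows from Thm 3.9.2 as typed — PROVED**: for number fields `F ⊆ K`,
a curve `E/F`, `l ≤ B`, and NOS in the typed form `RamifiedIffConductorOrDifferent E l` ("`e(w/p) > 1 ⟺
w | Cond(E/F) or w | Diff(F/ℚ)` for `w ∤ l` over `v`"): every prime `p > B` dividing `|Disc(K/ℚ)|` divides
`|Disc(F/ℚ)|` or `N𝔣(E/F)` (p.33 l.3), hence `Σ_{p | |Disc(K/ℚ)|, p>B} ln p ≤ ln|Disc(F/ℚ)| + ln N𝔣(E/F)`.
Print's (8.5) has `2(…)/[F:ℚ]` on the right; that sharpening is (8.6), not obtained here.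
[cite: DupuyHilado2020, Lemma 8.4.1 (8.5) p.32 l.51–59; proof p.33 l.1–21] -/
theorem sum_log_largePrimes_discr_le_of_NOS {F : Type*} [Field F] [NumberField F]
    (K : Type*) [Field K] [NumberField K] [Algebra F K] (E : WeierstrassCurve F) (l B : ℕ) (hlB : l ≤ B)
    (hNOS : RamifiedIffConductorOrDifferent (K := K) E l) :
    (∑ p ∈ (NumberField.discr K).natAbs.primeFactors.filter (fun p => B < p), Real.log p) ≤
      Real.log |(NumberField.discr F : ℝ)| + Real.log (E.conductorNorm (𝓞 F)) :=
  sum_log_largePrimes_discr_le_of_NOS_onlyIf K E l B hlB fun w v hv hne h1 => (hNOS w v hv hne).mp h1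

/-! ## §8.6 run on the weak form: (8.10) with the coefficient `[F:ℚ]/4` -/

variable {F₀ : Type*} [Field F₀] [NumberField F₀] (X : PilotData F₀) (R : SectionRamification F₀)

/-- **The §8.6 assembly with the large-primes input in the form NOS yields** (p.35 l.1–59 re-run): from
(8.9), (8.3), (8.4) with `B = B_{l,d₀}`, (8.7), (3.2) (typed hypotheses, as in `ineq810_of_inputs`) and
`Σ_{p | |Disc(K/ℚ)|, p>B} ln p ≤ ln|Disc(F/ℚ)| + ln N𝔣(E/F)` in place of (8.5):
`(1/(24+ε_l))·ln|Δ^min_{E/F}| ≤ [ln(B)π(B) + ln π]·[F:ℚ] + ([F:ℚ]/4)·(ln|Disc(F/ℚ)| + ln N𝔣(E/F))`.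
Compare the typed `Ineq810` (coefficient `1` on the last term). [cite: DupuyHilado2020, §8.6 (8.10) p.35 l.1–59] -/
theorem ineq810_weak_of_inputs (T : Finset ℕ)
    (lnμI : (p : ℕ) → (j : ℕ) → (Fin (j + 1) → placesOver F₀ p) → ℝ) (gArch : ℕ → ℝ)
    {F : Type*} [Field F] [NumberField F] (K : Type*) [Field K] [NumberField K] (E : WeierstrassCurve F)
    (h89 : Ineq89 X R T lnμI gArch) (h83 : ArchBound83 X gArch)
    (h84 : LargePlacesBound84 X R T lnμI (Bld0 X.l (Module.finrank ℚ F₀)) (NumberField.discr K).natAbs)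
    (hL : (∑ p ∈ (NumberField.discr K).natAbs.primeFactors.filter
        (fun p => Bld0 X.l (Module.finrank ℚ F₀) < p), Real.log p) ≤
      Real.log |(NumberField.discr F : ℝ)| + Real.log (E.conductorNorm (𝓞 F)))
    (h87 : SmallPlacesBound87 X R T lnμI (Bld0 X.l (Module.finrank ℚ F₀)))
    (h32 : PilotDegreeFormula X E) :
    (1 / (24 + epsExplicit X.l)) * Real.log (E.minimalDiscriminantNorm (𝓞 F)) ≤
      (Real.log (Bld0 X.l (Module.finrank ℚ F₀)) * Nat.primeCounting (Bld0 X.l (Module.finrank ℚ F₀)) +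
          Real.log Real.pi) * Module.finrank ℚ F +
        ((Module.finrank ℚ F : ℝ) / 4) *
          (Real.log |(NumberField.discr F : ℝ)| + Real.log (E.conductorNorm (𝓞 F))) := by
  classical
  set B : ℕ := Bld0 X.l (Module.finrank ℚ F₀) with hB
  have hl2 := X.two_le_lstar
  have hLs : (2 : ℝ) ≤ X.lstar := by exact_mod_cast hl2
  have h4 : 4 ≤ X.l := by have := X.five_le_l; omega
  have hdF : (0 : ℝ) < Module.finrank ℚ F := by exact_mod_cast Module.finrank_pos
  have hP1 : 0 ≤ Real.log (B : ℝ) * (Nat.primeCounting B : ℝ) :=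
    mul_nonneg (Real.log_natCast_nonneg B) (Nat.cast_nonneg _)
  have hLπ : 0 ≤ Real.log Real.pi := Real.log_nonneg (by linarith [Real.pi_gt_three])
  have hDisc : 0 ≤ Real.log |(NumberField.discr F : ℝ)| := by
    apply Real.log_nonneg
    have h1 : (1 : ℤ) ≤ |NumberField.discr F| := Int.one_le_abs (NumberField.discr_ne_zero F)
    have h2 : ((1 : ℤ) : ℝ) ≤ ((|NumberField.discr F| : ℤ) : ℝ) := by exact_mod_cast h1
    simpa [Int.cast_abs] using h2
  have hCond : 0 ≤ Real.log (E.conductorNorm (𝓞 F) : ℝ) := Real.log_natCast_nonneg _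
  have hsplit : ∑ p ∈ T, E2prime X R lnμI p =
      (∑ p ∈ T.filter (fun p => p ≤ B), E2prime X R lnμI p) +
        ∑ p ∈ T.filter (fun p => B < p), E2prime X R lnμI p := by
    rw [← Finset.sum_filter_add_sum_filter_not T (fun p => p ≤ B)]
    congr 2
    exact Finset.filter_congr fun p _ => not_le
  set Q : ℝ := Real.log (E.minimalDiscriminantNorm (𝓞 F)) with hQ
  set dF : ℝ := (Module.finrank ℚ F : ℝ) with hdF'
  set S : ℝ := Real.log |(NumberField.discr F : ℝ)| + Real.log (E.conductorNorm (𝓞 F)) with hS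
  set P1 : ℝ := Real.log (B : ℝ) * (Nat.primeCounting B : ℝ) with hP1'
  have hS0 : 0 ≤ S := add_nonneg hDisc hCond
  -- the right-hand side before dividing by `l + 5`
  have key : ((((X.lstar : ℝ) + 1) * (2 * X.lstar + 1) / 6) - 1) * ((1 / (2 * (X.l : ℝ))) * (Q / dF)) ≤
      ((2 * (X.lstar : ℝ) + 1) + 3) * P1 + (((2 * (X.lstar : ℝ) + 1) + 5) / 4) * S
        + (((2 * (X.lstar : ℝ) + 1) + 5) / 4) * Real.log Real.pi := by
    have hlhs : LgpDivisor.ndegLgp X.thetaPilot - FinDivisor.ndeg F₀ X.qPilot =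
        ((((X.lstar : ℝ) + 1) * (2 * X.lstar + 1) / 6) - 1) * ((1 / (2 * (X.l : ℝ))) * (Q / dF)) := by
      unfold PilotDegreeFormula at h32
      rw [ndegLgp_thetaPilot, h32]
      ring
    unfold Ineq89 at h89
    unfold ArchBound83 at h83
    unfold LargePlacesBound84 at h84
    unfold SmallPlacesBound87 at h87
    rw [hlhs, hsplit] at h89
    have h84' := h84.trans (mul_le_mul_of_nonneg_left hL (by positivity))
    have e87 : ((2 * (X.lstar : ℝ) + 1) + 3) * Real.log ↑B * ↑(Nat.primeCounting B) =
        ((2 * (X.lstar : ℝ) + 1) + 3) * P1 := by rw [hP1']; ring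
    linarith
  have hcoef : 1 / (24 + epsExplicit X.l) =
      ((((X.lstar : ℝ) + 1) * (2 * X.lstar + 1) / 6) - 1) * (1 / (2 * (X.l : ℝ))) * (1 / ((X.l : ℝ) + 5)) := by
    rw [← explicitCoeff_eq X.l h4, X.l_cast]
    ring
  rw [hcoef]
  rw [X.l_cast] at key ⊢
  have hl5 : (0 : ℝ) < (2 * (X.lstar : ℝ) + 1) + 5 := by positivity
  have step1 : ((((X.lstar : ℝ) + 1) * (2 * X.lstar + 1) / 6) - 1) * (1 / (2 * (2 * (X.lstar : ℝ) + 1))) *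
        (1 / ((2 * (X.lstar : ℝ) + 1) + 5)) * Q =
      (((((X.lstar : ℝ) + 1) * (2 * X.lstar + 1) / 6) - 1) * ((1 / (2 * (2 * (X.lstar : ℝ) + 1))) * (Q / dF)))
        * (dF / ((2 * (X.lstar : ℝ) + 1) + 5)) := by
    field_simp
  have step2 : (((((X.lstar : ℝ) + 1) * (2 * X.lstar + 1) / 6) - 1) * ((1 / (2 * (2 * (X.lstar : ℝ) + 1))) * (Q / dF)))
        * (dF / ((2 * (X.lstar : ℝ) + 1) + 5)) ≤
      (((2 * (X.lstar : ℝ) + 1) + 3) * P1 + (((2 * (X.lstar : ℝ) + 1) + 5) / 4) * S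
        + (((2 * (X.lstar : ℝ) + 1) + 5) / 4) * Real.log Real.pi) * (dF / ((2 * (X.lstar : ℝ) + 1) + 5)) :=
    mul_le_mul_of_nonneg_right key (by positivity)
  have step3 : (((2 * (X.lstar : ℝ) + 1) + 3) * P1 + (((2 * (X.lstar : ℝ) + 1) + 5) / 4) * S
        + (((2 * (X.lstar : ℝ) + 1) + 5) / 4) * Real.log Real.pi) * (dF / ((2 * (X.lstar : ℝ) + 1) + 5)) =
      (((2 * (X.lstar : ℝ) + 1) + 3) / ((2 * (X.lstar : ℝ) + 1) + 5)) * (P1 * dF) + (dF / 4) * S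
        + (Real.log Real.pi * dF) / 4 := by
    field_simp
  have step4 : (((2 * (X.lstar : ℝ) + 1) + 3) / ((2 * (X.lstar : ℝ) + 1) + 5)) * (P1 * dF) ≤ P1 * dF := by
    refine mul_le_of_le_one_left (mul_nonneg hP1 hdF.le) ?_
    rw [div_le_one hl5]
    linarith
  have hπdF : 0 ≤ Real.log Real.pi * dF := mul_nonneg hLπ hdF.le
  calc ((((X.lstar : ℝ) + 1) * (2 * X.lstar + 1) / 6) - 1) * (1 / (2 * (2 * (X.lstar : ℝ) + 1))) *
          (1 / ((2 * (X.lstar : ℝ) + 1) + 5)) * Q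
      = (((((X.lstar : ℝ) + 1) * (2 * X.lstar + 1) / 6) - 1) * ((1 / (2 * (2 * (X.lstar : ℝ) + 1))) * (Q / dF)))
          * (dF / ((2 * (X.lstar : ℝ) + 1) + 5)) := step1
    _ ≤ (((2 * (X.lstar : ℝ) + 1) + 3) / ((2 * (X.lstar : ℝ) + 1) + 5)) * (P1 * dF) + (dF / 4) * S
          + (Real.log Real.pi * dF) / 4 := step2.trans_eq step3
    _ ≤ (P1 + Real.log Real.pi) * dF + (dF / 4) * S := by nlinarith [step4, hS0, hπdF]

/-- **(8.10), weak form, from the (⟹) half of Thm 3.9.2** (`ineq810_weak_of_inputs` ∘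
`sum_log_largePrimes_discr_le_of_NOS_onlyIf`; `l ≤ B_{l,d₀}` holds as `d₁ ≥ 1`, `[F₀:ℚ] ≥ 1`): the true
(Néron–Ogg–Shafarevich) direction "`e(w/p) > 1 ⟹ w ∣ Cond(E/F) or w ∣ Diff(F/ℚ)`" for `F ⊆ K` replaces the
input (8.5), at the price of the coefficient `[F:ℚ]/4`. [cite: DupuyHilado2020, §8.4–§8.6 p.32 l.51 – p.35 l.59] -/
theorem ineq810_weak_of_NOS_onlyIf (T : Finset ℕ)
    (lnμI : (p : ℕ) → (j : ℕ) → (Fin (j + 1) → placesOver F₀ p) → ℝ) (gArch : ℕ → ℝ)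
    {F : Type*} [Field F] [NumberField F] (K : Type*) [Field K] [NumberField K] [Algebra F K]
    (E : WeierstrassCurve F)
    (h89 : Ineq89 X R T lnμI gArch) (h83 : ArchBound83 X gArch)
    (h84 : LargePlacesBound84 X R T lnμI (Bld0 X.l (Module.finrank ℚ F₀)) (NumberField.discr K).natAbs)
    (hNOS : ∀ (w : HeightOneSpectrum (𝓞 K)) (v : HeightOneSpectrum (𝓞 F)), w.asIdeal.under (𝓞 F) = v.asIdeal →
      residueChar K w ≠ X.l → 1 < ramIdx K w → E.conductor (𝓞 F) ≤ v.asIdeal ∨ 1 < ramIdx F v)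
    (h87 : SmallPlacesBound87 X R T lnμI (Bld0 X.l (Module.finrank ℚ F₀)))
    (h32 : PilotDegreeFormula X E) :
    (1 / (24 + epsExplicit X.l)) * Real.log (E.minimalDiscriminantNorm (𝓞 F)) ≤
      (Real.log (Bld0 X.l (Module.finrank ℚ F₀)) * Nat.primeCounting (Bld0 X.l (Module.finrank ℚ F₀)) +
          Real.log Real.pi) * Module.finrank ℚ F +
        ((Module.finrank ℚ F : ℝ) / 4) *
          (Real.log |(NumberField.discr F : ℝ)| + Real.log (E.conductorNorm (𝓞 F))) := by
  have hlB : X.l ≤ Bld0 X.l (Module.finrank ℚ F₀) := by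
    have h1 : 1 ≤ Module.finrank ℚ F₀ := Module.finrank_pos
    have hl : 1 ≤ X.l := by have := X.five_le_l; omega
    unfold Bld0 d1
    calc X.l = 1 * X.l ^ 1 * 1 := by ring
      _ ≤ 276480 * X.l ^ 4 * Module.finrank ℚ F₀ :=
        Nat.mul_le_mul (Nat.mul_le_mul (by norm_num) (Nat.pow_le_pow_right hl (by norm_num))) h1
  exact ineq810_weak_of_inputs X R T lnμI gArch K E h89 h83 h84
    (sum_log_largePrimes_discr_le_of_NOS_onlyIf K E X.l _ hlB hNOS) h87 h32

/-- **(8.10), weak form, from NOS as typed** (`ineq810_weak_of_inputs` ∘ `sum_log_largePrimes_discr_le_of_NOS`;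
`l ≤ B_{l,d₀}` holds as `d₁ ≥ 1`, `[F₀:ℚ] ≥ 1`): the typed Thm 3.9.2 for `F ⊆ K` replaces the input (8.5),
at the price of the coefficient `[F:ℚ]/4`. [cite: DupuyHilado2020, §8.4–§8.6 p.32 l.51 – p.35 l.59] -/
theorem ineq810_weak_of_NOS (T : Finset ℕ)
    (lnμI : (p : ℕ) → (j : ℕ) → (Fin (j + 1) → placesOver F₀ p) → ℝ) (gArch : ℕ → ℝ)
    {F : Type*} [Field F] [NumberField F] (K : Type*) [Field K] [NumberField K] [Algebra F K]
    (E : WeierstrassCurve F)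
    (h89 : Ineq89 X R T lnμI gArch) (h83 : ArchBound83 X gArch)
    (h84 : LargePlacesBound84 X R T lnμI (Bld0 X.l (Module.finrank ℚ F₀)) (NumberField.discr K).natAbs)
    (hNOS : RamifiedIffConductorOrDifferent (K := K) E X.l)
    (h87 : SmallPlacesBound87 X R T lnμI (Bld0 X.l (Module.finrank ℚ F₀)))
    (h32 : PilotDegreeFormula X E) :
    (1 / (24 + epsExplicit X.l)) * Real.log (E.minimalDiscriminantNorm (𝓞 F)) ≤
      (Real.log (Bld0 X.l (Module.finrank ℚ F₀)) * Nat.primeCounting (Bld0 X.l (Module.finrank ℚ F₀)) +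
          Real.log Real.pi) * Module.finrank ℚ F +
        ((Module.finrank ℚ F : ℝ) / 4) *
          (Real.log |(NumberField.discr F : ℝ)| + Real.log (E.conductorNorm (𝓞 F))) :=
  ineq810_weak_of_NOS_onlyIf X R T lnμI gArch K E h89 h83 h84 (fun w v hv hne h1 => (hNOS w v hv hne).mp h1)
    h87 h32

end ExplicitSzpiro

end Literature.IUT.LogVolume

end
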